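import Summits.QuantumAdvantage.QuantumAdvantage.Theorems.MobiusLadderLiouvilleNotPPolyStubTwinsRefute

/-!
# A polynomial-time generator of Liouville twins puts `L_λ` in `P` (stub `stub_twinsInP`, the
uniform twin of `stub_twinsRefute`; line `Sketch` for the crux `MobiusLadder.LiouvilleNotPPoly`,
stmt-QuantumAdvantage-1389)

Helper file (continuation lead c2, line `Sketch`, wave 2). Given

* the Jacobi symbol `(a | b)` computed on codes in polynomial time (T1a, a hypothesis here),
* the `2`-adic split `N ↦ (N / 2^{v₂(N)}, v₂(N) mod 2)` computed on codes in polynomial time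
  (T1b, a hypothesis here), and
* a polynomial-time GENERATOR `g : 1ⁿ ↦ d_n ∈ ℤ` (`CodeFP unE intE g`) whose outputs are, from some
  `n₀` on, Liouville twins of level `2^n` (`(d_n | p) = −1` at every odd prime `p ≤ 2^n`),

the Liouville language `L_λ = {bin N : λ(N) = −1}` is in `P`. The machine is the evaluator of
`stub_twinsRefute` with the advice replaced by a call of the generator on the input length: on an
`n`-symbol canonical numeral `x = bin N`, `N = 2^v · M` (`M` odd, `M ≤ N < 2^n`), it computes
`d := g'(1ⁿ)` and accepts iff `(−1)^v (d | M) = −1`, which is `λ(N) = −1` because twins compute `λ`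
on the odd numbers below their level (`TwinsRefute.sign_mul_jacobiSym_eq_neg_one_iff`, from
`jacobiSym_eq_liouville_of_twin`). The finitely many short lengths need no patch: the generator is
first REPAIRED inside polynomial time to `g' n := if n < n₀ then g n₀ else g n` (a branch on a
comparison of the unary input with the constant `n₀`), and `g n₀`, a twin of level `2^{n₀}`, is a
twin of every lower level, so `g'` outputs twins at every length.

Read contrapositively (sister summit PneNP, `LiouvilleNotInP`): `L_λ ∉ P` forbids every
polynomial-time twin generator. Theorems only; sorry-free.
-/

set_option linter.dupNamespace false -- D-0017: single-problem summit ⇒ `QuantumAdvantage.QuantumAdvantage` by design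

noncomputable section

namespace Summit.QuantumAdvantage.QuantumAdvantage.Theorems.LiouvilleNotPPoly

open _root_.Computability Literature.Computability.Complexity

namespace TwinsInP

open Literature.Computability.Complexity.Brick
open Literature.Computability.Complexity.CodeFP (pairE strE natE intE bitE unE)
open Summit.QuantumAdvantage.QuantumAdvantage.Theorems.LiouvilleNotPPoly.TwinsRefute

/-! ### Repairing the generator below `n₀` -/

/-- **The repaired generator is polynomial-time**: `1ⁿ ↦ if n < n₀ then g n₀ else g n` is computed
on codes (compare the unary input, read in binary, with the constant `n₀`; branch between the
constant `g n₀` and `g`). -/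
theorem codeFP_repair {g : ℕ → ℤ} (hg : CodeFP unE intE g) (n₀ : ℕ) :
    CodeFP unE intE (fun n : ℕ => if decide (n < n₀) then g n₀ else g n) := by
  have hlt : CodeFP unE bitE (fun n : ℕ => decide (n < n₀)) :=
    (CodeFP.natLt.comp (CodeFP.natOfUn.pair (CodeFP.const unE (eβ := natE) n₀))).congr
      fun _ => rfl
  exact hlt.ite (CodeFP.const unE (eβ := intE) (g n₀)) hg

/-- **The repaired generator outputs twins at every level**: below `n₀` it returns `g n₀`, a twin
of level `2^{n₀} ≥ 2^n`; from `n₀` on it returns `g n`. -/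
theorem repair_twin {g : ℕ → ℤ} {n₀ : ℕ}
    (h : ∀ n : ℕ, n₀ ≤ n → ∀ p : ℕ, p.Prime → p ≠ 2 → p ≤ 2 ^ n → jacobiSym (g n) p = -1)
    (n : ℕ) : ∀ p : ℕ, p.Prime → p ≠ 2 → p ≤ 2 ^ n →
      jacobiSym (if decide (n < n₀) then g n₀ else g n) p = -1 := by
  intro p hp hp2 hpn
  split_ifs with hlt
  · have hn : n < n₀ := by simpa using hlt
    exact h n₀ le_rfl p hp hp2 (hpn.trans (Nat.pow_le_pow_right Nat.two_pos hn.le))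
  · have hn : ¬ n < n₀ := by simpa using hlt
    exact h n (not_lt.1 hn) p hp hp2 hpn

/-! ### The uniform evaluator bit and its polynomial-time computability on codes -/

/-- **The uniform evaluator bit is computed on codes in polynomial time** (strings coded by
themselves, `strE`): on `x` it is
`[bin ⟦x⟧ = x ∧ (−1)^{v₂(⟦x⟧)} · (g |x| | ⟦x⟧ / 2^{v₂(⟦x⟧)}) = −1]`, assembled from the Jacobi
symbol, the `2`-adic split and the generator on codes by typed `CodeFP` plumbing (`strVal`,
`strOfNat`, `eq`, `strLength`, `ite`, `intMul`, `intEq`, `and`) — the evaluator of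
`TwinsRefute.codeFP_evalBit` with the advice `ival adv` replaced by `g |x|`. -/
theorem codeFP_evalBit {g : ℕ → ℤ}
    (hJ : CodeFP (pairE intE natE) intE (fun q : ℤ × ℕ => jacobiSym q.1 q.2))
    (hS : CodeFP natE (pairE natE bitE)
      (fun N : ℕ => (N / 2 ^ padicValNat 2 N, Nat.bodd (padicValNat 2 N))))
    (hg : CodeFP unE intE g) :
    CodeFP strE bitE (fun x : List Bool =>
      decide (encodeNat (bitsToNat x) = x) &&
        decide ((if Nat.bodd (padicValNat 2 (bitsToNat x)) then (-1 : ℤ) else 1) *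
          jacobiSym (g x.length) (bitsToNat x / 2 ^ padicValNat 2 (bitsToNat x)) = -1)) := by
  have hN : CodeFP strE natE (fun x : List Bool => bitsToNat x) := CodeFP.strVal
  have hcanon : CodeFP strE bitE (fun x : List Bool => decide (encodeNat (bitsToNat x) = x)) :=
    ((CodeFP.eq (eα := strE) Function.injective_id).comp
      ((CodeFP.strOfNat.comp hN).pair (CodeFP.id strE))).congr fun _ => rfl
  have hd : CodeFP strE intE (fun x : List Bool => g x.length) := hg.comp CodeFP.strLength
  have hsplit := hS.comp hN
  have hM : CodeFP strE natE
      (fun x : List Bool => bitsToNat x / 2 ^ padicValNat 2 (bitsToNat x)) :=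
    hsplit.fst'
  have hb : CodeFP strE bitE
      (fun x : List Bool => Nat.bodd (padicValNat 2 (bitsToNat x))) :=
    hsplit.snd'
  -- (no type ascriptions from here on: unifying a stated `fun x => jacobiSym …` against the
  -- composite makes the elaborator unfold the arithmetic; the shapes are fixed by `rfl` below)
  have hsgn := hb.ite (CodeFP.const strE (eβ := intE) (-1 : ℤ))
    (CodeFP.const strE (eβ := intE) (1 : ℤ))
  have hj := hJ.comp (hd.pair hM)
  have hprod := CodeFP.intMul.comp (hsgn.pair hj)
  have hacc :=
    CodeFP.intEq.comp (hprod.pair (CodeFP.const strE (eβ := intE) (-1 : ℤ)))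
  refine (hcanon.and hacc).congr fun p => ?_
  rfl

/-! ### Twins at every level put `L_λ` in `P` -/

/-- **A polynomial-time generator of twins AT EVERY LEVEL puts `L_λ` in `P`**: the language of the
uniform evaluator is in `P` (`TwinsRefute.lang_mem_P`) and equals `L_λ` — on a canonical numeral
`x = bin N` of length `n` (`N < 2^n`) the acceptance test `(−1)^{v₂ N} (g n | N / 2^{v₂ N}) = −1`
is `λ(N) = −1` (`TwinsRefute.sign_mul_jacobiSym_eq_neg_one_iff`; `N = 0` is rejected,
`TwinsRefute.sign_mul_jacobiSym_zero_ne`), and non-canonical strings are rejected. -/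
theorem liouville_mem_P {g : ℕ → ℤ}
    (hJ : CodeFP (pairE intE natE) intE (fun q : ℤ × ℕ => jacobiSym q.1 q.2))
    (hS : CodeFP natE (pairE natE bitE)
      (fun N : ℕ => (N / 2 ^ padicValNat 2 N, Nat.bodd (padicValNat 2 N))))
    (hg : CodeFP unE intE g)
    (htw : ∀ n : ℕ, ∀ p : ℕ, p.Prime → p ≠ 2 → p ≤ 2 ^ n → jacobiSym (g n) p = -1) :
    encodingNatBool.toLanguage {N : ℕ | ArithmeticFunction.liouville N = -1} ∈ Classes.P := by
  obtain ⟨f, hf, hfE⟩ := codeFP_evalBit hJ hS hg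
  have hEq : encodingNatBool.toLanguage {N : ℕ | ArithmeticFunction.liouville N = -1} =
      ({w | f w = [true]} : Language Bool) := by
    ext y
    have hfy : f y = [decide (encodeNat (bitsToNat y) = y) &&
        decide ((if Nat.bodd (padicValNat 2 (bitsToNat y)) then (-1 : ℤ) else 1) *
          jacobiSym (g y.length) (bitsToNat y / 2 ^ padicValNat 2 (bitsToNat y)) = -1)] :=
      hfE y
    have hmemLL : y ∈ encodingNatBool.toLanguage {N : ℕ | ArithmeticFunction.liouville N = -1} ↔
        ∃ N : ℕ, ArithmeticFunction.liouville N = -1 ∧ encodeNat N = y := by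
      show y ∈ encodingNatBool.encode '' _ ↔ _
      simp only [Set.mem_image, Set.mem_setOf_eq]
      rfl
    show y ∈ encodingNatBool.toLanguage {N : ℕ | ArithmeticFunction.liouville N = -1} ↔ f y = [true]
    rw [hmemLL, hfy]
    simp only [List.singleton_inj, Bool.and_eq_true, decide_eq_true_eq]
    constructor
    · rintro ⟨N, hNS, rfl⟩
      have hN0 : N ≠ 0 := by
        rintro rfl
        simp at hNS
      rw [bitsToNat_encodeNat]
      exact ⟨rfl, (sign_mul_jacobiSym_eq_neg_one_iff (htw _) hN0
        (lt_two_pow_of_length_encodeNat rfl).le).2 hNS⟩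
    · rintro ⟨hcanon, hacc⟩
      have hN0 : bitsToNat y ≠ 0 := by
        intro h0
        rw [h0] at hacc
        exact sign_mul_jacobiSym_zero_ne _ hacc
      have hy' : (encodeNat (bitsToNat y)).length = y.length := by rw [hcanon]
      exact ⟨bitsToNat y, (sign_mul_jacobiSym_eq_neg_one_iff (htw _) hN0
        (lt_two_pow_of_length_encodeNat hy').le).1 hacc, hcanon⟩
  rw [hEq]
  exact lang_mem_P hf

end TwinsInP

/-- **STUB · `stub_twinsInP` — A POLYNOMIAL-TIME TWIN GENERATOR PUTS `L_λ` IN `P`** (the uniform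
twin of `stub_twinsRefute`). Given the Jacobi symbol and the `2`-adic split on codes in polynomial
time and a polynomial-time generator `g : 1ⁿ ↦ d_n` with `d_n` a twin of level `2^n` for all
`n ≥ n₀`: repair `g` below `n₀` to the constant `g n₀` (`TwinsInP.codeFP_repair`, still polynomial
time; twins at every level, `TwinsInP.repair_twin`), then run the evaluator of `stub_twinsRefute`
with `d := g'(1^{|x|})` in place of the advice (`TwinsInP.codeFP_evalBit`): on an `n`-symbol
canonical numeral `N = 2^v · M` it outputs `[(−1)^v (d | M) = −1] = [λ(N) = −1]`
(`jacobiSym_eq_liouville_of_twin`), so its language, in `P`, is `L_λ` (`TwinsInP.liouville_mem_P`). -/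
theorem stub_twinsInP : Literature.Computability.Complexity.CodeFP (Literature.Computability.Complexity.CodeFP.pairE Literature.Computability.Complexity.CodeFP.intE Literature.Computability.Complexity.CodeFP.natE) Literature.Computability.Complexity.CodeFP.intE (fun q : ℤ × ℕ => jacobiSym q.1 q.2) → Literature.Computability.Complexity.CodeFP Literature.Computability.Complexity.CodeFP.natE (Literature.Computability.Complexity.CodeFP.pairE Literature.Computability.Complexity.CodeFP.natE Literature.Computability.Complexity.CodeFP.bitE) (fun N : ℕ => (N / 2 ^ padicValNat 2 N, Nat.bodd (padicValNat 2 N))) → ∀ g : ℕ → ℤ, Literature.Computability.Complexity.CodeFP Literature.Computability.Complexity.CodeFP.unE Literature.Computability.Complexity.CodeFP.intE g → (∃ n₀ : ℕ, ∀ n : ℕ, n₀ ≤ n → ∀ p : ℕ, p.Prime → p ≠ 2 → p ≤ 2 ^ n → jacobiSym (g n) p = -1) → Computability.encodingNatBool.toLanguage {N : ℕ | ArithmeticFunction.liouville N = -1} ∈ Literature.Computability.Complexity.Classes.P := by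
  intro hJ hS g hg hT
  obtain ⟨n₀, hn₀⟩ := hT
  exact TwinsInP.liouville_mem_P hJ hS (TwinsInP.codeFP_repair hg n₀) (TwinsInP.repair_twin hn₀)

end Summit.QuantumAdvantage.QuantumAdvantage.Theorems.LiouvilleNotPPoly

end
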